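import Summits.QuantumFields.YangMills.Theorems.BalabanUVNodesN15TwoSpacingGluingAdjoint
import HarnessLib

/-!
# THE GLUING STEP AT TWO LATTICE SPACINGS — THE ADJOINT ARRANGEMENT WITH PER-CUBE RIGHT-LOCALITY DEFECTS: `G₀Δ = 1 − (R̃ − Σ_□M_{h_□}Ẽ_□)`, the adjoint glued operator
# `(1 − R̃_D)⁻¹G₀` is THE inverse (hence equal to the right-glued one), and ENTRY 2 of (3.42) — `𝒢∘E` for a right factor `E` (`E = ∇*_U`) — with its two-spacing η-defect, generic
# (dag-n15-c g18, FILE 147; N15 = NE2, s1 «background-layer OPERATOR ingredient»)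

Cell `pub-ymgap`, seat `pub-ymgap-dag-n15-c` (R134 (a); HUMAN RULING D-0062), generation 18.  `bears_on: R4∕N15 · K3⁸ SpineGivenEndpointR13SepCoPHV (stmt-QuantumFields-27366)`.
Filed `--kind proof --supports stmt-QuantumFields-27366 --as helper` — COUNT-NEUTRAL.  Theorems only; 0 `def`, 0 `sorry`.  Imports BY NAME FILE 49 `…TwoSpacingGluingAdjoint` (`remainderL`,
`hasMaj_remainderL`, `hasMaj_idef_remainderL`; through it FILE 47 `…TwoSpacingGluingEntries` (`parametrix_comp_of_leibniz`, `hasMaj_parametrix_comp`, `hasMaj_idef_parametrix_comp`,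
`ind_mul_ind_le`), FILE 45 (`parametrix`, `commOp`, `sum_mulOp_sq`, `hasMaj_diag_comp`, `hasMaj_sum_overlap`, `idef_fsum`), FILE 44 (`glueInvL`, `glueInvL_comp_lap`, `lap_comp_glueInvL`,
`hasMaj_idef_glueInvL_comp`), FILE 43 (`neumannR`, `isUnit_neumannR`, `hasMaj_neumannR`); lit `T4EtaRateDefect.idef`, `T4EtaRateCoeffDefect.hasMaj_mulOp`∕`hasMaj_idef_mulOp`,
`B6Prop26Gluing.mulOp`∕`ind`, `B11SectG.hasMaj_comp_exp`).  Nothing in the tree is modified.  MIRROR of dag-n15-w3 file 32 `…CurvedGluingCubeDefectGluing` (right arrangement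
`ΔG₀ = 1 − (R − Σ_□E_□M_{h_□})`) and of FILE 136 `…TwoSpacingGluingGradientGluing` (left factors), transposed.

WHY.  The live-background `NE2PlusOperator` family (FILES 132∕135∕140∕145) has entries 0, 1, 3 of (3.42) (`G`, `∇_UG`, `Δ_UG`) and a SECOND left gradient in the slot of entry 2; the printed
entry 2 is the RIGHT-composed `G∇*_U` (`B9.KernelFamily.e 2` = *«|(G∇*_Uλ)(x)|»*).  Block sup-majorants (`B11SectG.HasMaj` on `BlockNorm.ofBlocks`) are ℓ∞-row bounds and are NOT
transpose-invariant (a transpose costs the number of lattice points per block, an η-dependent factor), so `𝒢∘∇* = (∇∘𝒢)ᵀ` is useless and the right-composed entry must ride on the ADJOINT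
arrangement `𝒢 = (1 − R̃)⁻¹G₀` ([B6] (2.91)–(2.93): both-sided expansions), in which a right factor passes into the parametrix slot: `𝒢∘E = Ñ∘(G₀∘E)` and `G₀∘E = Σ_□[M_{h_□}(G_□∘E)M_{h^s_□} +
M_{h_□}G_□M_{dh_□}]` by the adjoint Leibniz rule `M_{h_□}∘E = E∘M_{h^s_□} + M_{dh_□}` (FILE 47).  FILE 49 typed the adjoint pair for EXACT cube inverses (`G_□∘Δ∘M_{h_□} = M_{h_□}`); the
live family's dressed cubes invert `Δ` only up to locality defects, on the right as on the left: `G_□∘Δ∘M_{h_□} = M_{h_□} + Ẽ_□`.  THIS FILE is the adjoint gluing with such defects.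

WHAT.  §1 `cube_comp_lap_of_defect`, ★ `parametrix_comp_lap_of_defect` (`G₀∘Δ = 1 − (R̃ − Σ_□M_{h_□}Ẽ_□)`, `R̃ = remainderL Δ h G`).  §2 letters: `hasMaj_defectSumL` (`Σ_□M_{h_□}Ẽ_□ ≤ N_ov·ε`),
★ `hasMaj_remainderLD` (`R̃ − Σ_□M_{h_□}Ẽ_□ ≤ N_ov(θ₀ + ε)e^{−δd}` from two-sided adjoint commutator rows `G_□∘[Δ, M_{h_□}] ≤ 1_S1_Sθ₀` and defect rows `Ẽ_□ ≤ 1_S1_Sε`), `hasMaj_idef_defectSumL`,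
★ `hasMaj_idef_remainderLD` (two grids: `≤ N_ov(r + oθ₀ + r_E + oε)`).  §3 ★★ `glued_adjoint_inverse_of_defect` (`Σ_□h_□² = 1`, the right-locality-with-defect identities, the letter `θ` of
`R̃_D` with `θc_r < 1` ⟹ `glueInvL R̃_D G₀` inverts `Δ` on BOTH sides), ★ `glueInvL_eq_of_lap_comp` (UNIQUENESS: it equals ANY right inverse of `Δ` — at the cover: the right-glued `cvGlued`
of FILES 119–146, whose `Δ∘cvGlued = 1` is dag-n15-w3 file 32 `glued_inverse_of_defect`), `hasMaj_neumannR_comp` (`Ñ∘P ≤ (1 − θc_r)⁻¹Ac_r·e^{−(δ−2σ)d}`).  §4 ★★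
`hasMaj_glueInvL_parametrix_comp_of_cutRows_defect` — ENTRY 2, ONE GRID: cube rows `G_□ ≤ 1_S1_Sβ`, right entries `G_□∘E ≤ 1_S1_Sβ₂`, adjoint Leibniz letters `|h| ≤ 1`, `|h^s| ≤ c_s`,
`|dh| ≤ c_d`, adjoint commutator rows `θ₀`, defect rows `ε`, overlap `N_ov`, `N_ov(θ₀ + ε)c_r < 1`, `2σ ≤ δ` ⟹ `glueInvL R̃_D G₀ ∘ E ≤ (1 − N_ov(θ₀+ε)c_r)⁻¹N_ov(β₂c_s + βc_d)c_r·e^{−(δ−2σ)d}`;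
★★★ `hasMaj_idef_glueInvL_parametrix_comp_of_cutRows_defect` — ITS TWO-SPACING η-DEFECT along `π`: the same data on both grids, the partition fits `o, o_s, o_d`, the per-cube η-defects of
the cube rows (`m₀`), of the right entries (`m₂`), of the adjoint commutator rows (`r`), of the defect rows (`r_E`) ⟹ `𝔇_π(Ñ′∘(G₀′∘E′), Ñ∘(G₀∘E)) ≤ […]·e^{−(δ−2σ)d}` with FILE 44's explicit
constant (`hasMaj_idef_glueInvL_comp`).  CONSUMER: the adjoint form of dag-n15-w3's dressed smooth-cut cube (next file: right entries WITHOUT mixed `∇N∇` rows), then the cover.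

HONEST FRAMING ∕ LIMITS.  Generic block-majorant bookkeeping (abstract lattice `X`, carrier `g`, operators `Δ`, `E`, cubes `G_□`, defects `Ẽ_□`); proves NO estimate of any concrete
propagator — the per-cube right entries, adjoint commutator rows, right-locality defects and their η-defects are HYPOTHESES (their instantiation for the live dressed cubes at the cover is
the located next step); (2.36), (2.91)–(2.93), (2.133)–(2.136) of [Balaban1984PropagatorsII] and (3.42), Thm 3.14 of [Balaban1985BackgroundPropagators] are cited as SHAPES ∕ MECHANISM ∕
TEMPLATE; nothing of [B5]∕[B6]∕[B9] asserted.  NE2⁺ NOT PRINTED, NOT proved; N15 NOT discharged; K3⁸ OPEN, skeleton v7 untouched (0∕2); counts of record UNMOVED (typed 28∕28 · discharged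
6∕27 · A 6∕28); one finite 𝕋⁴ at fixed ε — NOT infinite volume, NOT OS on ℝ⁴, NOT a mass gap, NOT Clay; R4 closes the conditional finite-𝕋⁴ rung `BalabanLadder.UV` only.  Restate-immune
(no Theses import).
-/

noncomputable section

open scoped BigOperators

namespace Summit.QuantumFields.YangMills.BalabanUVNodes.N15.Gluing

open Literature.MathematicalPhysics.QuantumFieldTheory.Balaban1983to89
open Literature.MathematicalPhysics.QuantumFieldTheory.Balaban1983to89.B11SectG (BlockNorm HasMaj RowSum hasMaj_comp_exp)
open Literature.MathematicalPhysics.QuantumFieldTheory.Balaban1983to89.B6RandomWalk (Triangle254)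
open Literature.MathematicalPhysics.QuantumFieldTheory.Balaban1983to89.T4EtaRateDefect (idef idef_apply idef_comp idef_add idef_sub)
open Literature.MathematicalPhysics.QuantumFieldTheory.Balaban1983to89.T4EtaRateCoeffDefect (pull pull_apply diagK diagK_nonneg hasMaj_mulOp hasMaj_idef_mulOp)
open Literature.MathematicalPhysics.QuantumFieldTheory.Balaban1983to89.B6Prop26Gluing (mulOp mulOp_apply ind ind_nonneg ind_le_one)

/-! ## §1 The adjoint parametrix identity with per-cube right-locality defects -/

section Identity

variable {X : Type} {ι : Type} [Fintype ι]

/-- One cube, adjoint side, with a defect: `G∘Δ∘M_a = M_a + Ẽ` ⟹ `(M_aGM_a)∘Δ = M_a² + M_aẼ − M_aG[Δ, M_a]` (FILE 49 `cube_comp_lap` is the case `Ẽ = 0`).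
[cite: Balaban1984PropagatorsII, (2.91)–(2.92) p.239 (mechanism, transposed)] -/
theorem cube_comp_lap_of_defect {Δ G E : (X → ℝ) →ₗ[ℝ] (X → ℝ)} {a : X → ℝ} (hloc : G ∘ₗ Δ ∘ₗ mulOp a = mulOp a + E) :
    (mulOp a ∘ₗ G ∘ₗ mulOp a) ∘ₗ Δ = mulOp a ∘ₗ mulOp a + mulOp a ∘ₗ E - mulOp a ∘ₗ G ∘ₗ commOp Δ a := by
  have h1 : mulOp a ∘ₗ Δ = Δ ∘ₗ mulOp a - commOp Δ a := by rw [commOp]; abel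
  calc (mulOp a ∘ₗ G ∘ₗ mulOp a) ∘ₗ Δ = mulOp a ∘ₗ G ∘ₗ (mulOp a ∘ₗ Δ) := by simp only [LinearMap.comp_assoc]
    _ = mulOp a ∘ₗ (G ∘ₗ Δ ∘ₗ mulOp a) - mulOp a ∘ₗ G ∘ₗ commOp Δ a := by rw [h1, LinearMap.comp_sub, LinearMap.comp_sub]
    _ = mulOp a ∘ₗ mulOp a + mulOp a ∘ₗ E - mulOp a ∘ₗ G ∘ₗ commOp Δ a := by rw [hloc, LinearMap.comp_add]

/-- ★ **THE ADJOINT PARAMETRIX IDENTITY WITH PER-CUBE RIGHT-LOCALITY DEFECTS**: `Σ_□h_□² = 1` ((2.36)) and `G_□∘Δ∘M_{h_□} = M_{h_□} + Ẽ_□` for every cube ⟹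
`G₀∘Δ = 1 − (R̃ − Σ_□M_{h_□}Ẽ_□)` with FILE 45's `G₀ = parametrix h G` and FILE 49's adjoint remainder `R̃ = remainderL Δ h G` (FILE 49 `parametrix_comp_lap` is the case `Ẽ ≡ 0`;
dag-n15-w3 file 32 `lap_comp_parametrix_of_defect` is the right-arrangement twin). [cite: Balaban1984PropagatorsII, (2.36) p.229, (2.91)–(2.92) p.239 (mechanism, transposed)] -/
theorem parametrix_comp_lap_of_defect {Δ : (X → ℝ) →ₗ[ℝ] (X → ℝ)} {h : ι → X → ℝ} {G E : ι → (X → ℝ) →ₗ[ℝ] (X → ℝ)} (h236 : ∀ x, ∑ i, h i x ^ 2 = 1)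
    (hloc : ∀ i, G i ∘ₗ Δ ∘ₗ mulOp (h i) = mulOp (h i) + E i) :
    parametrix h G ∘ₗ Δ = LinearMap.id - (remainderL Δ h G - ∑ i, mulOp (h i) ∘ₗ E i) := by
  have hsum : parametrix h G ∘ₗ Δ = ∑ i, (mulOp (h i) ∘ₗ G i ∘ₗ mulOp (h i)) ∘ₗ Δ :=
    LinearMap.ext fun v => by simp only [parametrix, LinearMap.comp_apply, LinearMap.coe_sum, Finset.sum_apply]
  have hterm : ∀ i, (mulOp (h i) ∘ₗ G i ∘ₗ mulOp (h i)) ∘ₗ Δ = mulOp (h i) ∘ₗ mulOp (h i) + mulOp (h i) ∘ₗ E i - mulOp (h i) ∘ₗ G i ∘ₗ commOp Δ (h i) :=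
    fun i => cube_comp_lap_of_defect (hloc i)
  rw [hsum, Finset.sum_congr rfl fun i _ => hterm i, Finset.sum_sub_distrib, Finset.sum_add_distrib, sum_mulOp_sq h h236, remainderL]
  abel

end Identity

/-! ## §2 Letters of the adjoint defect sum and of the full adjoint remainder, one grid and two grids -/

section Letters

variable {X X' : Type} [Fintype X] [Fintype X'] {ι : Type} [Fintype ι] {g : B6.Geometry} (blk : X → g.Site) (π : X' → X) (S : ι → Set g.Site)

omit [Fintype X'] in
/-- ★ **THE ADJOINT DEFECT SUM's LETTER**: two-sided localized defect rows `Ẽ_□ ≤ 1_{S_□}(y)1_{S_□}(y′)·εe^{−δd}`, `|h_□| ≤ 1`, bounded overlap `Σ_□1_{S_□} ≤ N_ov` ⟹ `Σ_□M_{h_□}Ẽ_□ ≤ N_ov·ε·e^{−δd}`.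
[cite: Balaban1984PropagatorsII, (2.134)–(2.135) p.247 (bounded-overlap mechanism)] -/
theorem hasMaj_defectSumL {h : ι → X → ℝ} {E : ι → (X → ℝ) →ₗ[ℝ] (X → ℝ)} {ε δ Nov : ℝ} (hε : 0 ≤ ε) (hh : ∀ i x, |h i x| ≤ 1) (hN : ∀ a, ∑ i, ind (S i) a ≤ Nov)
    (hE : ∀ i, HasMaj (BlockNorm.ofBlocks g blk) (BlockNorm.ofBlocks g blk) (E i) (fun y y' => ind (S i) y * ind (S i) y' * (ε * Real.exp (-(δ * g.dist y y'))))) :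
    HasMaj (BlockNorm.ofBlocks g blk) (BlockNorm.ofBlocks g blk) (∑ i, mulOp (h i) ∘ₗ E i) (fun y y' => Nov * (ε * Real.exp (-(δ * g.dist y y')))) := by
  have hterm : ∀ i, HasMaj (BlockNorm.ofBlocks g blk) (BlockNorm.ofBlocks g blk) (mulOp (h i) ∘ₗ E i) (fun y y' => ind (S i) y * (ε * Real.exp (-(δ * g.dist y y')))) := fun i => by
    have hMa := hasMaj_mulOp (g := g) blk (m := fun _ => (1 : ℝ)) (fun _ => zero_le_one) (hh i)
    refine (hasMaj_diag_comp blk (fun _ => zero_le_one) hMa (hE i)).mono fun y y' => ?_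
    have key := ind_mul_ind_le (Sc := S i) (A := ε * Real.exp (-(δ * g.dist y y'))) (mul_nonneg hε (Real.exp_nonneg _)) y y'
    calc (1 : ℝ) * (ind (S i) y * ind (S i) y' * (ε * Real.exp (-(δ * g.dist y y')))) = ind (S i) y * ind (S i) y' * (ε * Real.exp (-(δ * g.dist y y'))) := one_mul _
      _ ≤ _ := key
  exact hasMaj_sum_overlap (b₁ := BlockNorm.ofBlocks g blk) (b₃ := BlockNorm.ofBlocks g blk) _ S _ Nov (fun y y' => mul_nonneg hε (Real.exp_nonneg _)) hterm hN

omit [Fintype X'] in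
/-- ★ **THE FULL ADJOINT REMAINDER's LETTER**: two-sided adjoint commutator rows `G_□∘[Δ, M_{h_□}] ≤ 1_S1_S·θ₀e^{−δd}` (FILE 49) and two-sided defect rows `Ẽ_□ ≤ 1_S1_S·εe^{−δd}` ⟹
`R̃ − Σ_□M_{h_□}Ẽ_□ ≤ N_ov(θ₀ + ε)·e^{−δd}`. [cite: Balaban1984PropagatorsII, (2.135) p.247 (shape, transposed)] -/
theorem hasMaj_remainderLD {Δ : (X → ℝ) →ₗ[ℝ] (X → ℝ)} {h : ι → X → ℝ} {G E : ι → (X → ℝ) →ₗ[ℝ] (X → ℝ)} {θ₀ ε δ Nov : ℝ} (hθ : 0 ≤ θ₀) (hε : 0 ≤ ε) (hh : ∀ i x, |h i x| ≤ 1)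
    (hN : ∀ a, ∑ i, ind (S i) a ≤ Nov)
    (hKc : ∀ i, HasMaj (BlockNorm.ofBlocks g blk) (BlockNorm.ofBlocks g blk) (G i ∘ₗ commOp Δ (h i)) (fun y y' => ind (S i) y * ind (S i) y' * (θ₀ * Real.exp (-(δ * g.dist y y')))))
    (hE : ∀ i, HasMaj (BlockNorm.ofBlocks g blk) (BlockNorm.ofBlocks g blk) (E i) (fun y y' => ind (S i) y * ind (S i) y' * (ε * Real.exp (-(δ * g.dist y y'))))) :
    HasMaj (BlockNorm.ofBlocks g blk) (BlockNorm.ofBlocks g blk) (remainderL Δ h G - ∑ i, mulOp (h i) ∘ₗ E i) (fun y y' => Nov * (θ₀ + ε) * Real.exp (-(δ * g.dist y y'))) := by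
  refine ((hasMaj_remainderL blk S hθ hh hN hKc).sub (hasMaj_defectSumL blk S hε hh hN hE)).mono fun y y' => le_of_eq ?_
  ring

/-- ★ **THE ADJOINT DEFECT SUM's η-DEFECT**: coarse defect rows `Ẽ_□ ≤ 1_S1_S·εe^{−δd}`, their two-grid defects `𝔇(Ẽ′_□, Ẽ_□) ≤ 1_S1_S·r_Ee^{−δd}`, fine `|h′_□| ≤ 1`, fit `|h′_□ − h_□∘π| ≤ o`, overlap ⟹
`𝔇(Σ_□M_{h′_□}Ẽ′_□, Σ_□M_{h_□}Ẽ_□) ≤ N_ov(r_E + oε)·e^{−δd}`. [cite: Balaban1985BackgroundPropagators, Thm 3.14 pp.426–427 (difference template); Balaban1984PropagatorsII, (2.135) p.247] -/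
theorem hasMaj_idef_defectSumL {h : ι → X → ℝ} {h' : ι → X' → ℝ} {E : ι → (X → ℝ) →ₗ[ℝ] (X → ℝ)} {E' : ι → (X' → ℝ) →ₗ[ℝ] (X' → ℝ)} {ε rE o δ Nov : ℝ} (hε : 0 ≤ ε) (hrE : 0 ≤ rE)
    (ho : 0 ≤ o) (hh' : ∀ i x', |h' i x'| ≤ 1) (hfit : ∀ i x', |h' i x' - h i (π x')| ≤ o) (hN : ∀ a, ∑ i, ind (S i) a ≤ Nov)
    (hE : ∀ i, HasMaj (BlockNorm.ofBlocks g blk) (BlockNorm.ofBlocks g blk) (E i) (fun y y' => ind (S i) y * ind (S i) y' * (ε * Real.exp (-(δ * g.dist y y')))))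
    (hDE : ∀ i, HasMaj (BlockNorm.ofBlocks g blk) (BlockNorm.ofBlocks g (blk ∘ π)) (idef (pull π) (pull π) (E' i) (E i)) (fun y y' => ind (S i) y * ind (S i) y' * (rE * Real.exp (-(δ * g.dist y y'))))) :
    HasMaj (BlockNorm.ofBlocks g blk) (BlockNorm.ofBlocks g (blk ∘ π)) (idef (pull π) (pull π) (∑ i, mulOp (h' i) ∘ₗ E' i) (∑ i, mulOp (h i) ∘ₗ E i))
      (fun y y' => Nov * ((1 * rE + o * ε) * Real.exp (-(δ * g.dist y y')))) := by
  have hterm : ∀ i, HasMaj (BlockNorm.ofBlocks g blk) (BlockNorm.ofBlocks g (blk ∘ π)) (idef (pull π) (pull π) (mulOp (h' i) ∘ₗ E' i) (mulOp (h i) ∘ₗ E i))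
      (fun y y' => ind (S i) y * ((1 * rE + o * ε) * Real.exp (-(δ * g.dist y y')))) := fun i => by
    have hMa' := hasMaj_mulOp (g := g) (blk ∘ π) (m := fun _ => (1 : ℝ)) (fun _ => zero_le_one) (hh' i)
    have hDM := hasMaj_idef_mulOp (g := g) blk π (o := fun _ => o) (fun _ => ho) (fun x' => hfit i x')
    have t1 := hasMaj_diag_comp (blk ∘ π) (fun _ => zero_le_one) hMa' (hDE i)
    have t2 := hasMaj_diag_comp blk (fun _ => ho) hDM (hE i)
    rw [idef_comp (pull π) (pull π) (pull π)]
    refine (t1.add t2).mono fun y y' => ?_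
    have key := ind_mul_ind_le (Sc := S i) (A := (1 * rE + o * ε) * Real.exp (-(δ * g.dist y y'))) (mul_nonneg (by positivity) (Real.exp_nonneg _)) y y'
    calc 1 * (ind (S i) y * ind (S i) y' * (rE * Real.exp (-(δ * g.dist y y')))) + o * (ind (S i) y * ind (S i) y' * (ε * Real.exp (-(δ * g.dist y y'))))
        = ind (S i) y * ind (S i) y' * ((1 * rE + o * ε) * Real.exp (-(δ * g.dist y y'))) := by ring
      _ ≤ _ := key
  rw [idef_fsum]
  exact hasMaj_sum_overlap (b₁ := BlockNorm.ofBlocks g blk) (b₃ := BlockNorm.ofBlocks g (blk ∘ π)) _ S _ Nov (fun y y' => mul_nonneg (by positivity) (Real.exp_nonneg _)) hterm hN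

/-- ★ **THE FULL ADJOINT REMAINDER's η-DEFECT**: FILE 49 `hasMaj_idef_remainderL` (`N_ov(r + oθ₀)`) plus ★ above ⟹ `𝔇(R̃′_D, R̃_D) ≤ N_ov(r + oθ₀ + r_E + oε)·e^{−δd}`.
[cite: Balaban1985BackgroundPropagators, Thm 3.14 pp.426–427 (template); Balaban1984PropagatorsII, (2.134)–(2.135) p.247 (shapes)] -/
theorem hasMaj_idef_remainderLD {Δ : (X → ℝ) →ₗ[ℝ] (X → ℝ)} {Δ' : (X' → ℝ) →ₗ[ℝ] (X' → ℝ)} {h : ι → X → ℝ} {h' : ι → X' → ℝ} {G E : ι → (X → ℝ) →ₗ[ℝ] (X → ℝ)}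
    {G' E' : ι → (X' → ℝ) →ₗ[ℝ] (X' → ℝ)} {θ₀ r ε rE o δ Nov : ℝ} (hθ : 0 ≤ θ₀) (hr : 0 ≤ r) (hε : 0 ≤ ε) (hrE : 0 ≤ rE) (ho : 0 ≤ o) (hh' : ∀ i x', |h' i x'| ≤ 1)
    (hfit : ∀ i x', |h' i x' - h i (π x')| ≤ o) (hN : ∀ a, ∑ i, ind (S i) a ≤ Nov)
    (hKc : ∀ i, HasMaj (BlockNorm.ofBlocks g blk) (BlockNorm.ofBlocks g blk) (G i ∘ₗ commOp Δ (h i)) (fun y y' => ind (S i) y * ind (S i) y' * (θ₀ * Real.exp (-(δ * g.dist y y')))))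
    (hDK : ∀ i, HasMaj (BlockNorm.ofBlocks g blk) (BlockNorm.ofBlocks g (blk ∘ π)) (idef (pull π) (pull π) (G' i ∘ₗ commOp Δ' (h' i)) (G i ∘ₗ commOp Δ (h i)))
      (fun y y' => ind (S i) y * ind (S i) y' * (r * Real.exp (-(δ * g.dist y y')))))
    (hE : ∀ i, HasMaj (BlockNorm.ofBlocks g blk) (BlockNorm.ofBlocks g blk) (E i) (fun y y' => ind (S i) y * ind (S i) y' * (ε * Real.exp (-(δ * g.dist y y')))))
    (hDE : ∀ i, HasMaj (BlockNorm.ofBlocks g blk) (BlockNorm.ofBlocks g (blk ∘ π)) (idef (pull π) (pull π) (E' i) (E i)) (fun y y' => ind (S i) y * ind (S i) y' * (rE * Real.exp (-(δ * g.dist y y'))))) :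
    HasMaj (BlockNorm.ofBlocks g blk) (BlockNorm.ofBlocks g (blk ∘ π))
      (idef (pull π) (pull π) (remainderL Δ' h' G' - ∑ i, mulOp (h' i) ∘ₗ E' i) (remainderL Δ h G - ∑ i, mulOp (h i) ∘ₗ E i))
      (fun y y' => Nov * (1 * r + o * θ₀ + (1 * rE + o * ε)) * Real.exp (-(δ * g.dist y y'))) := by
  rw [idef_sub]
  refine ((hasMaj_idef_remainderL blk π S hθ hr ho hh' hfit hN hKc hDK).sub (hasMaj_idef_defectSumL blk π S hε hrE ho hh' hfit hN hE hDE)).mono fun y y' => le_of_eq ?_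
  ring

end Letters

/-! ## §3 The adjoint glued operator with defects: THE inverse (both sides), uniqueness, the resummed right factor -/

section Glued

variable {X : Type} [Fintype X] [DecidableEq X] {ι : Type} [Fintype ι] {g : B6.Geometry} (blk : X → g.Site) {σ cr : ℝ}

/-- ★★ **THE ADJOINT GLUED OPERATOR WITH DEFECTS IS A TWO-SIDED INVERSE**: `Σ_□h_□² = 1`, `G_□∘Δ∘M_{h_□} = M_{h_□} + Ẽ_□`, the adjoint-remainder-with-defects letter `R̃_D ≤ θe^{−δd}` with
`θc_r < 1` (`σ ≤ δ`) ⟹ `glueInvL R̃_D G₀ ∘ Δ = 1` AND `Δ ∘ glueInvL R̃_D G₀ = 1` (FILE 44 `glueInvL_comp_lap` ∕ `lap_comp_glueInvL` at the identity of §1).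
[cite: Balaban1984PropagatorsII, (2.91) p.239, (2.135)–(2.136) p.247 (mechanism, transposed)] -/
theorem glued_adjoint_inverse_of_defect (hd : ∀ a b : g.Site, 0 ≤ g.dist a b) (hrow : RowSum g σ cr) {Δ : (X → ℝ) →ₗ[ℝ] (X → ℝ)} {h : ι → X → ℝ} {G E : ι → (X → ℝ) →ₗ[ℝ] (X → ℝ)}
    {θ δ : ℝ} (hθ : 0 ≤ θ) (hσδ : σ ≤ δ) (h236 : ∀ x, ∑ i, h i x ^ 2 = 1) (hloc : ∀ i, G i ∘ₗ Δ ∘ₗ mulOp (h i) = mulOp (h i) + E i)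
    (hR : HasMaj (BlockNorm.ofBlocks g blk) (BlockNorm.ofBlocks g blk) (remainderL Δ h G - ∑ i, mulOp (h i) ∘ₗ E i) (fun y y' => θ * Real.exp (-(δ * g.dist y y')))) (hq : θ * cr < 1) :
    glueInvL (remainderL Δ h G - ∑ i, mulOp (h i) ∘ₗ E i) (parametrix h G) ∘ₗ Δ = LinearMap.id ∧
      Δ ∘ₗ glueInvL (remainderL Δ h G - ∑ i, mulOp (h i) ∘ₗ E i) (parametrix h G) = LinearMap.id := by
  have hunit := isUnit_neumannR blk hd hrow hθ hσδ hR hq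
  have h291 := parametrix_comp_lap_of_defect h236 hloc
  exact ⟨glueInvL_comp_lap hunit h291, lap_comp_glueInvL hunit h291⟩

omit [Fintype X] [DecidableEq X] in
/-- ★ **UNIQUENESS**: an adjoint glued operator that inverts `Δ` on the left EQUALS every right inverse of `Δ` — in particular the right-glued operator with defects of dag-n15-w3 file 32
(`glued_inverse_of_defect`: `Δ ∘ glueInv G₀ R_D = 1`), so ONE operator carries all four entries of (3.42). [folklore] -/
theorem glueInvL_eq_of_lap_comp {Δ G₀ R G : (X → ℝ) →ₗ[ℝ] (X → ℝ)} [Fintype X] [DecidableEq X] (hL : glueInvL R G₀ ∘ₗ Δ = LinearMap.id) (hinv : Δ ∘ₗ G = LinearMap.id) :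
    glueInvL R G₀ = G := by
  calc glueInvL R G₀ = glueInvL R G₀ ∘ₗ (Δ ∘ₗ G) := by rw [hinv, LinearMap.comp_id]
    _ = (glueInvL R G₀ ∘ₗ Δ) ∘ₗ G := by rw [LinearMap.comp_assoc]
    _ = G := by rw [hL, LinearMap.id_comp]

/-- ★ **THE RESUMMED RIGHT FACTOR, ONE GRID**: `P ≤ Ae^{−δd}`, `R ≤ θe^{−δd}`, `θc_r < 1`, `2σ ≤ δ` ⟹ `Ñ∘P ≤ (1 − θc_r)⁻¹Ac_r·e^{−(δ−2σ)d}` (FILE 43 `hasMaj_neumannR` at rate `δ − σ`, composed with one more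
row sum; the one-grid twin of FILE 44 `hasMaj_idef_glueInvL_comp`, same rate). [cite: Balaban1984PropagatorsII, Prop. 2.6 (2.136) p.247 (shape); (2.52)–(2.56) pp.232–233 (mechanism)] -/
theorem hasMaj_neumannR_comp (htri : Triangle254 g) (hd : ∀ a b : g.Site, 0 ≤ g.dist a b) (hd0 : ∀ y : g.Site, g.dist y y = 0) (hrow : RowSum g σ cr) (hσ : 0 ≤ σ)
    {P R : (X → ℝ) →ₗ[ℝ] (X → ℝ)} {A θ δ : ℝ} (hA : 0 ≤ A) (hθ : 0 ≤ θ) (hσδ : 2 * σ ≤ δ)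
    (hP : HasMaj (BlockNorm.ofBlocks g blk) (BlockNorm.ofBlocks g blk) P (fun y y' => A * Real.exp (-(δ * g.dist y y'))))
    (hR : HasMaj (BlockNorm.ofBlocks g blk) (BlockNorm.ofBlocks g blk) R (fun y y' => θ * Real.exp (-(δ * g.dist y y')))) (hq : θ * cr < 1) :
    HasMaj (BlockNorm.ofBlocks g blk) (BlockNorm.ofBlocks g blk) (neumannR R ∘ₗ P) (fun y y' => (1 - θ * cr)⁻¹ * A * cr * Real.exp (-((δ - 2 * σ) * g.dist y y'))) := by
  have hinv0 : 0 ≤ (1 - θ * cr)⁻¹ := inv_nonneg.2 (by linarith)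
  have hN := hasMaj_neumannR blk htri hd hd0 hrow (ρ := δ - σ) hθ (by linarith) (by linarith) hR hq
  have key := hasMaj_comp_exp (b₁ := BlockNorm.ofBlocks g blk) (b₂ := BlockNorm.ofBlocks g blk) (b₃ := BlockNorm.ofBlocks g blk) (T₁ := neumannR R) (T₂ := P) (ρ := δ - 2 * σ)
    htri hd hrow hinv0 hA (by linarith) (by linarith) (by linarith) hN hP
  refine key.mono fun a b => le_of_eq ?_
  rw [show (BlockNorm.ofBlocks g blk).κ = 1 from rfl]
  ring

end Glued

/-! ## §4 Entry 2 of (3.42) for the adjoint glued operator with defects: one grid, two grids -/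

section Entry

variable {X X' : Type} [Fintype X] [Fintype X'] [DecidableEq X] [DecidableEq X'] {ι : Type} [Fintype ι] {g : B6.Geometry} (blk : X → g.Site) (π : X' → X)
  (S : ι → Set g.Site) {σ cr : ℝ}

omit [Fintype X'] [DecidableEq X'] in
/-- ★★ **ENTRY 2 OF THE ADJOINT GLUED OPERATOR WITH DEFECTS, ONE GRID**: for a right factor `E` with the adjoint lattice Leibniz rule through the partition (`M_{h_□}∘E = E∘M_{h^s_□} + M_{dh_□}`,
`|h| ≤ 1`, `|h^s| ≤ c_s`, `|dh| ≤ c_d`), cube rows `G_□ ≤ 1_S1_S·βe^{−δd}`, right entries `G_□∘E ≤ 1_S1_S·β₂e^{−δd}`, adjoint commutator rows `θ₀`, right-locality defect rows `ε`, overlap `N_ov`,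
`N_ov(θ₀ + ε)c_r < 1`, `2σ ≤ δ`:  `glueInvL (R̃ − Σ_□M_{h_□}Ẽ_□) (Σ_□M_hG_□M_h) ∘ E ≤ (1 − N_ov(θ₀+ε)c_r)⁻¹·N_ov(β₂c_s + βc_d)·c_r·e^{−(δ−2σ)d}`.
[cite: Balaban1984PropagatorsII, (2.91)–(2.93) p.239, Prop. 2.6 (2.133)–(2.136) p.247 (shapes + mechanism, transposed); Balaban1985BackgroundPropagators, (3.42) p.397 (entry `G∇*_U`: shape)] -/
theorem hasMaj_glueInvL_parametrix_comp_of_cutRows_defect (htri : Triangle254 g) (hd : ∀ a b : g.Site, 0 ≤ g.dist a b) (hd0 : ∀ y : g.Site, g.dist y y = 0) (hrow : RowSum g σ cr)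
    (hσ : 0 ≤ σ) {Δ E : (X → ℝ) →ₗ[ℝ] (X → ℝ)} {h hs dh : ι → X → ℝ} {G Ed : ι → (X → ℝ) →ₗ[ℝ] (X → ℝ)} {β β₂ cs cd θ₀ ε δ Nov : ℝ} (hβ : 0 ≤ β) (hβ₂ : 0 ≤ β₂) (hcs : 0 ≤ cs)
    (hcd : 0 ≤ cd) (hθ : 0 ≤ θ₀) (hε : 0 ≤ ε) (hNov : 0 ≤ Nov) (hσδ : 2 * σ ≤ δ) (hleib : ∀ i, mulOp (h i) ∘ₗ E = E ∘ₗ mulOp (hs i) + mulOp (dh i))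
    (hh : ∀ i x, |h i x| ≤ 1) (hhs : ∀ i x, |hs i x| ≤ cs) (hdh : ∀ i x, |dh i x| ≤ cd) (hN : ∀ a, ∑ i, ind (S i) a ≤ Nov)
    (hG : ∀ i, HasMaj (BlockNorm.ofBlocks g blk) (BlockNorm.ofBlocks g blk) (G i) (fun y y' => ind (S i) y * ind (S i) y' * (β * Real.exp (-(δ * g.dist y y')))))
    (hGE : ∀ i, HasMaj (BlockNorm.ofBlocks g blk) (BlockNorm.ofBlocks g blk) (G i ∘ₗ E) (fun y y' => ind (S i) y * ind (S i) y' * (β₂ * Real.exp (-(δ * g.dist y y')))))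
    (hKc : ∀ i, HasMaj (BlockNorm.ofBlocks g blk) (BlockNorm.ofBlocks g blk) (G i ∘ₗ commOp Δ (h i)) (fun y y' => ind (S i) y * ind (S i) y' * (θ₀ * Real.exp (-(δ * g.dist y y')))))
    (hEd : ∀ i, HasMaj (BlockNorm.ofBlocks g blk) (BlockNorm.ofBlocks g blk) (Ed i) (fun y y' => ind (S i) y * ind (S i) y' * (ε * Real.exp (-(δ * g.dist y y')))))
    (hq : Nov * (θ₀ + ε) * cr < 1) :
    HasMaj (BlockNorm.ofBlocks g blk) (BlockNorm.ofBlocks g blk) (glueInvL (remainderL Δ h G - ∑ i, mulOp (h i) ∘ₗ Ed i) (parametrix h G) ∘ₗ E)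
      (fun y y' => (1 - Nov * (θ₀ + ε) * cr)⁻¹ * (Nov * (β₂ * cs + β * cd)) * cr * Real.exp (-((δ - 2 * σ) * g.dist y y'))) := by
  have hP := hasMaj_parametrix_comp blk S hβ hβ₂ hcs hcd hleib hh hhs hdh hN hG hGE
  rw [glueInvL, LinearMap.comp_assoc]
  exact hasMaj_neumannR_comp blk htri hd hd0 hrow hσ (by positivity) (mul_nonneg hNov (add_nonneg hθ hε)) hσδ hP (hasMaj_remainderLD blk S hθ hε hh hN hKc hEd) hq

/-- ★★★ **… AND ITS TWO-SPACING η-DEFECT** (two grids along `π`): the same data on both grids (coarse `E`, fine `E′` with their adjoint Leibniz rules), the partition fits `|h′ − h∘π| ≤ o`,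
`|h^s′ − h^s∘π| ≤ o_s`, `|dh′ − dh∘π| ≤ o_d`, and the per-cube η-defects of the cube rows (`m₀`), of the right entries (`m₂`), of the adjoint commutator rows (`r`), of the defect rows (`r_E`) ⟹
`𝔇_π(Ñ′∘(G₀′∘E′), Ñ∘(G₀∘E)) ≤ [(1−q)⁻¹m̂c_r + (1−q)⁻¹(r̂((1−q)⁻¹Âc_r)c_r)c_r]·e^{−(δ−2σ)d}` with `q = N_ov(θ₀+ε)c_r`, `Â = N_ov(β₂c_s + βc_d)`, `r̂ = N_ov(r + oθ₀ + r_E + oε)`,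
`m̂ = N_ov[(β₂o_s + m₂c_s + oβ₂c_s) + (βo_d + m₀c_d + oβc_d)]` (FILE 44 `hasMaj_idef_glueInvL_comp` on FILE 47 `hasMaj_idef_parametrix_comp` and ★ `hasMaj_idef_remainderLD`).
[cite: Balaban1985BackgroundPropagators, Thm 3.14 pp.426–427 (difference template), (3.42) p.397 (entry `G∇*_U`: shape); Balaban1984PropagatorsII, (2.91)–(2.93) p.239, (2.133)–(2.136) p.247] -/
theorem hasMaj_idef_glueInvL_parametrix_comp_of_cutRows_defect (htri : Triangle254 g) (hd : ∀ a b : g.Site, 0 ≤ g.dist a b) (hd0 : ∀ y : g.Site, g.dist y y = 0) (hrow : RowSum g σ cr)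
    (hσ : 0 ≤ σ) (hcr : 0 ≤ cr) {Δ E : (X → ℝ) →ₗ[ℝ] (X → ℝ)} {Δ' E' : (X' → ℝ) →ₗ[ℝ] (X' → ℝ)} {h hs dh : ι → X → ℝ} {h' hs' dh' : ι → X' → ℝ} {G Ed : ι → (X → ℝ) →ₗ[ℝ] (X → ℝ)}
    {G' Ed' : ι → (X' → ℝ) →ₗ[ℝ] (X' → ℝ)} {β β₂ cs cd o os od m₀ m₂ θ₀ ε r rE δ Nov : ℝ} (hβ : 0 ≤ β) (hβ₂ : 0 ≤ β₂) (hcs : 0 ≤ cs) (hcd : 0 ≤ cd) (ho : 0 ≤ o) (hos : 0 ≤ os)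
    (hod : 0 ≤ od) (hm₀ : 0 ≤ m₀) (hm₂ : 0 ≤ m₂) (hθ : 0 ≤ θ₀) (hε : 0 ≤ ε) (hr : 0 ≤ r) (hrE : 0 ≤ rE) (hNov : 0 ≤ Nov) (hσδ : 2 * σ ≤ δ)
    (hleib : ∀ i, mulOp (h i) ∘ₗ E = E ∘ₗ mulOp (hs i) + mulOp (dh i)) (hleib' : ∀ i, mulOp (h' i) ∘ₗ E' = E' ∘ₗ mulOp (hs' i) + mulOp (dh' i))
    (hh : ∀ i x, |h i x| ≤ 1) (hh' : ∀ i x', |h' i x'| ≤ 1) (hhs : ∀ i x, |hs i x| ≤ cs) (hdh : ∀ i x, |dh i x| ≤ cd)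
    (hfit : ∀ i x', |h' i x' - h i (π x')| ≤ o) (hfits : ∀ i x', |hs' i x' - hs i (π x')| ≤ os) (hfitd : ∀ i x', |dh' i x' - dh i (π x')| ≤ od) (hN : ∀ b, ∑ i, ind (S i) b ≤ Nov)
    (hG : ∀ i, HasMaj (BlockNorm.ofBlocks g blk) (BlockNorm.ofBlocks g blk) (G i) (fun y y' => ind (S i) y * ind (S i) y' * (β * Real.exp (-(δ * g.dist y y')))))
    (hG' : ∀ i, HasMaj (BlockNorm.ofBlocks g (blk ∘ π)) (BlockNorm.ofBlocks g (blk ∘ π)) (G' i) (fun y y' => ind (S i) y * ind (S i) y' * (β * Real.exp (-(δ * g.dist y y')))))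
    (hGE : ∀ i, HasMaj (BlockNorm.ofBlocks g blk) (BlockNorm.ofBlocks g blk) (G i ∘ₗ E) (fun y y' => ind (S i) y * ind (S i) y' * (β₂ * Real.exp (-(δ * g.dist y y')))))
    (hGE' : ∀ i, HasMaj (BlockNorm.ofBlocks g (blk ∘ π)) (BlockNorm.ofBlocks g (blk ∘ π)) (G' i ∘ₗ E') (fun y y' => ind (S i) y * ind (S i) y' * (β₂ * Real.exp (-(δ * g.dist y y')))))
    (hIG : ∀ i, HasMaj (BlockNorm.ofBlocks g blk) (BlockNorm.ofBlocks g (blk ∘ π)) (idef (pull π) (pull π) (G' i) (G i))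
      (fun y y' => ind (S i) y * ind (S i) y' * (m₀ * Real.exp (-(δ * g.dist y y')))))
    (hIGE : ∀ i, HasMaj (BlockNorm.ofBlocks g blk) (BlockNorm.ofBlocks g (blk ∘ π)) (idef (pull π) (pull π) (G' i ∘ₗ E') (G i ∘ₗ E))
      (fun y y' => ind (S i) y * ind (S i) y' * (m₂ * Real.exp (-(δ * g.dist y y')))))
    (hKc : ∀ i, HasMaj (BlockNorm.ofBlocks g blk) (BlockNorm.ofBlocks g blk) (G i ∘ₗ commOp Δ (h i)) (fun y y' => ind (S i) y * ind (S i) y' * (θ₀ * Real.exp (-(δ * g.dist y y')))))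
    (hKc' : ∀ i, HasMaj (BlockNorm.ofBlocks g (blk ∘ π)) (BlockNorm.ofBlocks g (blk ∘ π)) (G' i ∘ₗ commOp Δ' (h' i))
      (fun y y' => ind (S i) y * ind (S i) y' * (θ₀ * Real.exp (-(δ * g.dist y y')))))
    (hDK : ∀ i, HasMaj (BlockNorm.ofBlocks g blk) (BlockNorm.ofBlocks g (blk ∘ π)) (idef (pull π) (pull π) (G' i ∘ₗ commOp Δ' (h' i)) (G i ∘ₗ commOp Δ (h i)))
      (fun y y' => ind (S i) y * ind (S i) y' * (r * Real.exp (-(δ * g.dist y y')))))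
    (hEd : ∀ i, HasMaj (BlockNorm.ofBlocks g blk) (BlockNorm.ofBlocks g blk) (Ed i) (fun y y' => ind (S i) y * ind (S i) y' * (ε * Real.exp (-(δ * g.dist y y')))))
    (hEd' : ∀ i, HasMaj (BlockNorm.ofBlocks g (blk ∘ π)) (BlockNorm.ofBlocks g (blk ∘ π)) (Ed' i) (fun y y' => ind (S i) y * ind (S i) y' * (ε * Real.exp (-(δ * g.dist y y')))))
    (hDEd : ∀ i, HasMaj (BlockNorm.ofBlocks g blk) (BlockNorm.ofBlocks g (blk ∘ π)) (idef (pull π) (pull π) (Ed' i) (Ed i)) (fun y y' => ind (S i) y * ind (S i) y' * (rE * Real.exp (-(δ * g.dist y y')))))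
    (hq : Nov * (θ₀ + ε) * cr < 1) :
    HasMaj (BlockNorm.ofBlocks g blk) (BlockNorm.ofBlocks g (blk ∘ π))
      (idef (pull π) (pull π) (glueInvL (remainderL Δ' h' G' - ∑ i, mulOp (h' i) ∘ₗ Ed' i) (parametrix h' G') ∘ₗ E')
        (glueInvL (remainderL Δ h G - ∑ i, mulOp (h i) ∘ₗ Ed i) (parametrix h G) ∘ₗ E))
      (fun y y' => ((1 - Nov * (θ₀ + ε) * cr)⁻¹ * (Nov * ((1 * β₂ * os + 1 * m₂ * cs + o * β₂ * cs) + (1 * β * od + 1 * m₀ * cd + o * β * cd))) * cr +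
          (1 - Nov * (θ₀ + ε) * cr)⁻¹ * ((Nov * (1 * r + o * θ₀ + (1 * rE + o * ε))) * ((1 - Nov * (θ₀ + ε) * cr)⁻¹ * (Nov * (β₂ * cs + β * cd)) * cr) * cr) * cr) *
        Real.exp (-((δ - 2 * σ) * g.dist y y'))) := by
  have hP := hasMaj_parametrix_comp blk S hβ hβ₂ hcs hcd hleib hh hhs hdh hN hG hGE
  have hIP := hasMaj_idef_parametrix_comp blk π S hβ hβ₂ hcs hcd ho hos hod hm₀ hm₂ hleib hleib' hh' hhs hdh hfit hfits hfitd hN hG hG' hGE hGE' hIG hIGE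
  rw [glueInvL, glueInvL, LinearMap.comp_assoc, LinearMap.comp_assoc]
  exact hasMaj_idef_glueInvL_comp blk π htri hd hd0 hrow hσ hcr (by positivity) (mul_nonneg hNov (add_nonneg hθ hε)) (mul_nonneg hNov (by positivity)) (mul_nonneg hNov (by positivity)) hσδ hP
    (hasMaj_remainderLD blk S hθ hε hh hN hKc hEd) (hasMaj_remainderLD (blk ∘ π) S hθ hε hh' hN hKc' hEd') hIP
    (hasMaj_idef_remainderLD blk π S hθ hr hε hrE ho hh' hfit hN hKc hDK hEd hDEd) hq

end Entry

end Summit.QuantumFields.YangMills.BalabanUVNodes.N15.Gluing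

end
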